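import Summits.CriticalPhenomena.PercolationContinuityZ3.Theorems.PercNearOneGluingNoHeavyLowerTailSunflowerTwoGenCoreBox
import Mathlib.Data.Fintype.Pi
import HarnessLib

/-!
# `NoHeavyLowerTail` (crux stmt-CriticalPhenomena-4575), abstract sunflower cubic: BOX EVENTS for a product of blocks and their peeling law

Support file (seat `prim-ineq-prove-1` gen 34; `--supports stmt-CriticalPhenomena-4575`).  No `sorry`, no named facts.  Memo:
run/shared/lean/prim/prim-ineq-prove-1/FINDING-PRINCIPALCORE-prove1-g34.md §3.  Inputs: cylinders (`…SunflowerTwoGenCoreBox`).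

SETTING.  `ι` finite, `μ = prodBernoulli p`; blocks indexed by a finite type `β`, with pairwise disjoint DOMAINS `D k : Finset ι`; grid points
`v : β → ι` with `v ∈ Fintype.piFinset D`.  For a set `B` of ACTIVE blocks and `U : Finset (β → ι)`, the BOX EVENT
  `Box B D U = {ω | every grid point all of whose active coordinates are missing from ω lies in U}`,
`zeta p B D U = μ(Box B D U)`.  (`B = univ`: "the box of missing coordinates is inside `U`"; inactive blocks range over their whole domain.)
* `Box_insert_inter_cyl` — PEELING an active block `k₀`: on the cylinder "the missing part of `D k₀` is `T`", `Box (insert k₀ B) D U` is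
  `Box B (update D k₀ T) U` (the block becomes inactive with domain `T`); hence the law `zeta_insert`:
  `zeta (insert k₀ B) D U = Σ_{T ⊆ D k₀} wmiss(T) · zeta B (update D k₀ T) U` (independence of the blocks).
* `Box_empty_active` / `zeta_empty_active` (no active block: a deterministic event), `Box_emptyset_eq` (`U = ∅`: "some active block is
  fully present"), antitonicity in an inactive domain (`Box_update_anti`).
USE: `…SunflowerBoxLemma` (the box lemma `∏_i zeta B D (U i) ≤ (zeta B D ∅)^(K−1)`), `…SunflowerDeltaCore`.
-/

noncomputable section

namespace Summit.CriticalPhenomena.PercolationContinuityZ3.Theorems.SunflowerPartition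

namespace BoxLemma

open MeasureTheory Finset
open Literature.Probability.LatticeModels Literature.Probability.Percolation TwoGenCore

variable {ι : Type*} [DecidableEq ι] {β : Type*} [Fintype β] [DecidableEq β]

/-! ## The box event -/

/-- The box event with active blocks `B`, domains `D`, target set `U`. [this work] -/
def Box (B : Finset β) (D : β → Finset ι) (U : Finset (β → ι)) : Set (Set ι) :=
  {ω | ∀ v ∈ Fintype.piFinset D, (∀ k ∈ B, v k ∉ ω) → v ∈ U}

/-- Its probability. [this work] -/
def zeta (p : ι → unitInterval) (B : Finset β) (D : β → Finset ι) (U : Finset (β → ι)) : ℝ := (prodBernoulli p).real (Box B D U)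

omit [DecidableEq ι] in
/-- `Box` is monotone in `U`. [this work] -/
theorem Box_mono {B : Finset β} {D : β → Finset ι} {U U' : Finset (β → ι)} (h : ∀ v ∈ Fintype.piFinset D, v ∈ U → v ∈ U') :
    Box B D U ⊆ Box B D U' := fun _ hω v hv hmiss => h v hv (hω v hv hmiss)

omit [DecidableEq ι] in
/-- `Box` is antitone in an inactive domain. [this work] -/
theorem Box_update_anti {B : Finset β} {D : β → Finset ι} {k₀ : β} {T T' : Finset ι} (hTT' : T ⊆ T') (U : Finset (β → ι)) :
    Box B (Function.update D k₀ T') U ⊆ Box B (Function.update D k₀ T) U := by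
  intro ω hω v hv hmiss
  refine hω v ?_ hmiss
  rw [Fintype.mem_piFinset] at hv ⊢
  intro k
  have hvk := hv k
  by_cases hk : k = k₀
  · subst hk; rw [Function.update_self] at hvk ⊢; exact hTT' hvk
  · rw [Function.update_of_ne hk] at hvk ⊢; exact hvk

omit [DecidableEq ι] in
/-- An empty inactive domain makes the box event sure. [this work] -/
theorem Box_update_empty (B : Finset β) (D : β → Finset ι) (k₀ : β) (U : Finset (β → ι)) :
    Box B (Function.update D k₀ ∅) U = Set.univ := by
  ext ω
  simp only [Box, Set.mem_setOf_eq, Set.mem_univ, iff_true]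
  intro v hv
  rw [Fintype.mem_piFinset] at hv
  have := hv k₀
  rw [Function.update_self] at this
  exact absurd this (Finset.notMem_empty _)

omit [DecidableEq ι] in
/-- With no active block the box event is deterministic. [this work] -/
theorem Box_empty_active (D : β → Finset ι) (U : Finset (β → ι)) :
    Box ∅ D U = {_ω | ∀ v ∈ Fintype.piFinset D, v ∈ U} := by
  ext ω; simp [Box]

omit [DecidableEq ι] in
/-- With `U = ∅` and nonempty inactive domains: "some active block is entirely present". [this work] -/
theorem Box_emptyset_eq {B : Finset β} {D : β → Finset ι} (hD : ∀ k, k ∉ B → (D k).Nonempty) :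
    Box B D ∅ = {ω | ∃ k ∈ B, ∀ e ∈ D k, e ∈ ω} := by
  classical
  ext ω
  simp only [Box, Set.mem_setOf_eq, Finset.notMem_empty, imp_false]
  constructor
  · intro h
    by_contra hcon
    push Not at hcon
    -- choose a missing coordinate in every active block, anything in the inactive ones
    have hch : ∀ k, ∃ e ∈ D k, k ∈ B → e ∉ ω := by
      intro k
      by_cases hk : k ∈ B
      · obtain ⟨e, he, heω⟩ := hcon k hk
        exact ⟨e, he, fun _ => heω⟩
      · obtain ⟨e, he⟩ := hD k hk
        exact ⟨e, he, fun h => absurd h hk⟩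
    choose v hv hvω using hch
    exact h v (Fintype.mem_piFinset.2 hv) (fun k hk => hvω k hk)
  · rintro ⟨k, hk, hkω⟩ v hv hmiss
    exact hmiss k hk (hkω (v k) (Fintype.mem_piFinset.1 hv k))

/-! ## Peeling an active block -/

/-- On the cylinder "the missing part of `D k₀` is `T`", peeling the active block `k₀` turns it into an inactive block with domain `T`. [this work] -/
theorem Box_insert_inter_cyl {B : Finset β} {k₀ : β} (hk₀ : k₀ ∉ B) (D : β → Finset ι) {T : Finset ι} (hT : T ⊆ D k₀)
    (U : Finset (β → ι)) :
    Box (insert k₀ B) D U ∩ cyl (D k₀) T = Box B (Function.update D k₀ T) U ∩ cyl (D k₀) T := by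
  ext ω
  simp only [Set.mem_inter_iff, and_congr_left_iff]
  intro hcyl
  have hiff : ∀ e ∈ D k₀, (e ∉ ω ↔ e ∈ T) := fun e he => by
    have := hcyl e he; tauto
  constructor
  · intro h v hv hmiss
    rw [Fintype.piFinset_update_eq_filter_piFinset_mem D k₀ hT, Finset.mem_filter] at hv
    refine h v hv.1 fun k hk => ?_
    rcases Finset.mem_insert.1 hk with rfl | hk
    · exact (hiff _ (Fintype.mem_piFinset.1 hv.1 k)).2 hv.2
    · exact hmiss k hk
  · intro h v hv hmiss
    refine h v ?_ fun k hk => hmiss k (Finset.mem_insert_of_mem hk)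
    rw [Fintype.piFinset_update_eq_filter_piFinset_mem D k₀ hT, Finset.mem_filter]
    exact ⟨hv, (hiff _ (Fintype.mem_piFinset.1 hv k₀)).1 (hmiss k₀ (Finset.mem_insert_self _ _))⟩

/-- `Box B D U` is determined by the coordinates of the active blocks. [this work] -/
theorem determinedBy_Box (B : Finset β) (D : β → Finset ι) (U : Finset (β → ι)) :
    DeterminedBy (Box B D U) (↑(B.biUnion D) : Set ι) :=
  determinedBy_of_mem fun _ _ hag hω v hv hmiss => hω v hv fun k hk hvk =>
    hmiss k hk ((hag (v k) (Finset.mem_biUnion.2 ⟨k, hk, Fintype.mem_piFinset.1 hv k⟩)).1 hvk)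

variable [Fintype ι]

/-- **Law of peeling**: `zeta (insert k₀ B) D U = Σ_{T ⊆ D k₀} wmiss(T) · zeta B (D[k₀ ↦ T]) U`. [this work] -/
theorem zeta_insert (p : ι → unitInterval) {B : Finset β} {k₀ : β} (hk₀ : k₀ ∉ B) {D : β → Finset ι}
    (hdisj : ∀ k l, k ≠ l → Disjoint (D k) (D l)) (U : Finset (β → ι)) :
    zeta p (insert k₀ B) D U = ∑ T ∈ (D k₀).powerset, wmiss p (D k₀) T * zeta p B (Function.update D k₀ T) U := by
  classical
  unfold zeta
  -- total probability over the cylinders of block `k₀`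
  have hcover : Box (insert k₀ B) D U = ⋃ T ∈ (D k₀).powerset, (Box (insert k₀ B) D U ∩ cyl (D k₀) T) := by
    ext ω
    simp only [Set.mem_iUnion, Set.mem_inter_iff, exists_and_left, exists_prop]
    constructor
    · intro h
      exact ⟨h, (D k₀).filter (· ∉ ω), Finset.mem_powerset.2 (Finset.filter_subset _ _),
        (mem_cyl_iff (Finset.filter_subset _ _)).2 rfl⟩
    · rintro ⟨h, -, -, -⟩; exact h
  rw [hcover, measureReal_biUnion_finset]
  · refine Finset.sum_congr rfl fun T hT => ?_
    rw [Finset.mem_powerset] at hT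
    rw [Box_insert_inter_cyl hk₀ D hT U]
    have hdet1 : DeterminedBy (Box B (Function.update D k₀ T) U) (↑(B.biUnion (Function.update D k₀ T)) : Set ι) :=
      determinedBy_Box _ _ _
    have hdet2 : DeterminedBy (cyl (D k₀) T) (↑(D k₀) : Set ι) :=
      determinedBy_of_mem fun ω ω' hag hω e he => (hag e he).symm.trans (hω e he)
    have hdisj' : Disjoint (B.biUnion (Function.update D k₀ T)) (D k₀) := by
      rw [Finset.disjoint_biUnion_left]
      intro k hk
      have hk' : k ≠ k₀ := ne_of_mem_of_not_mem hk hk₀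
      rw [Function.update_of_ne hk']
      exact hdisj k k₀ hk'
    rw [prodBernoulli_real_inter_of_determinedBy_disjoint p hdisj' hdet1 hdet2 MeasurableSet.of_discrete
      MeasurableSet.of_discrete, real_cyl p hT, mul_comm]
  · intro T hT T' hT' hne
    rw [Function.onFun, Set.disjoint_left]
    rintro ω ⟨-, hω⟩ ⟨-, hω'⟩
    rw [Finset.mem_coe, Finset.mem_powerset] at hT hT'
    exact hne (((mem_cyl_iff hT).1 hω).symm.trans ((mem_cyl_iff hT').1 hω'))
  · intro T _; exact MeasurableSet.of_discrete

/-- With no active block, `zeta` is `0` or `1`. [this work] -/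
theorem zeta_empty_active (p : ι → unitInterval) (D : β → Finset ι) (U : Finset (β → ι)) :
    zeta p ∅ D U = if ∀ v ∈ Fintype.piFinset D, v ∈ U then 1 else 0 := by
  unfold zeta
  rw [Box_empty_active]
  split_ifs with h
  · rw [show {_ω : Set ι | ∀ v ∈ Fintype.piFinset D, v ∈ U} = Set.univ from Set.eq_univ_of_forall fun _ => h]
    exact probReal_univ
  · rw [show {_ω : Set ι | ∀ v ∈ Fintype.piFinset D, v ∈ U} = ∅ from Set.eq_empty_of_forall_notMem fun _ h' => h h']
    exact measureReal_empty

end BoxLemma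

end Summit.CriticalPhenomena.PercolationContinuityZ3.Theorems.SunflowerPartition
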